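import Mathlib.Analysis.Calculus.ContDiff.Basic
import Mathlib.Analysis.Calculus.Deriv.Mul
import Mathlib.Analysis.Calculus.Deriv.Pow
import Mathlib.Analysis.Calculus.IteratedDeriv.Lemmas
import Mathlib.Tactic.Module
import HarnessLib

/-!
# Time derivatives of the deformed slice family (Bär–Hanke 2023, §3, (16)–(17))

A calculus brick (K5b of the notes) of the proof of the named fact
`Literature.Geometry.Riemannian.BarHanke2023_thm27_umbilicNormalForm`. In a chart the slices of
the deformed cylinder of `CylinderNormalFormMetric.lean` / `CylinderNormalFormChart.lean` are

  `g(s) = (1 − a s) f(s) + a s (1 − (C s² + 2 m χ s)) f₀ + a s (s − χ s) f₁`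

(`f(s) = F(p, s)` the original slices, `f₀ = F(p,0)`, `f₁ = Ḟ(p,0)`, `m = μ(ψ⁻¹ p)`). This file
records the first and second time derivatives of `g` (`hasDerivAt_normalFormSlice`,
`hasDerivAt_deriv_normalFormSlice`) and their two specialisations: where `a ≡ 1` near `t`
(Bär–Hanke (16)–(17): `γ̇_t = −2h − 2Ct g₀ + 2χ̇(h − k)`, `γ̈_t = −2C g₀ + 2χ̈ (h − k)` with
`h = −½ f₁`, `k = m f₀`; `deriv_normalFormSlice_of_regionB`, `deriv_deriv_normalFormSlice_of_regionB`)
and where `χ ≡ 0` near `t` (the `C`-normalisation `g = f + a w`,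
`w(s) = f₀ + s f₁ − C s² f₀ − f(s)`: `ġ = ḟ + ȧ w + a ẇ`, `g̈ = f̈ + ä w + 2ȧ ẇ + a ẅ`;
`deriv_normalFormSlice_of_regionA`, `deriv_deriv_normalFormSlice_of_regionA`).
Everything is proved; no definitions, no named facts (D-0026).

## References

* C. Bär, B. Hanke, *Boundary conditions for scalar curvature*, arXiv:2012.09127, §3, Prop. 23
  and proof of Prop. 26, (15)–(17). [BarHanke2023]
-/

noncomputable section

open Set Filter Function
open scoped Topology ContDiff

namespace Literature.Geometry.Riemannian

variable {W : Type*} [NormedAddCommGroup W] [NormedSpace ℝ W]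
  {f : ℝ → W} {a χ : ℝ → ℝ} {C m : ℝ} {f₀ f₁ : W}

/-- A `C^∞` real function has a differentiable derivative. [folklore] -/
theorem hasDerivAt_deriv_of_contDiff {φ : ℝ → ℝ} (hφ : ContDiff ℝ ∞ φ) (t : ℝ) :
    HasDerivAt (deriv φ) (deriv (deriv φ) t) t :=
  (((contDiff_infty_iff_deriv.1 hφ).2.differentiable (by simp)) t).hasDerivAt

/-- A `C^∞` vector function has a differentiable derivative. [folklore] -/
theorem hasDerivAt_deriv_of_contDiff_vec (hf : ContDiff ℝ ∞ f) (t : ℝ) :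
    HasDerivAt (deriv f) (deriv (deriv f) t) t :=
  (((contDiff_infty_iff_deriv.1 hf).2.differentiable (by simp)) t).hasDerivAt

/-- **First time derivative of the deformed slices**
`g(s) = (1 − a s) f(s) + a s (1 − (C s² + 2 m χ s)) f₀ + a s (s − χ s) f₁`.
[cite: BarHanke2023, §3, (15)–(16)] -/
theorem hasDerivAt_normalFormSlice (hf : ContDiff ℝ ∞ f) (ha : ContDiff ℝ ∞ a)
    (hχ : ContDiff ℝ ∞ χ) (t : ℝ) :
    HasDerivAt (fun s ↦ (1 - a s) • f s + (a s * (1 - (C * s ^ 2 + 2 * m * χ s))) • f₀ +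
        (a s * (s - χ s)) • f₁)
      (-(deriv a t) • f t + (1 - a t) • deriv f t +
        (deriv a t * (1 - (C * t ^ 2 + 2 * m * χ t)) +
          a t * (-(2 * C * t + 2 * m * deriv χ t))) • f₀ +
        (deriv a t * (t - χ t) + a t * (1 - deriv χ t)) • f₁) t := by
  have hda : HasDerivAt a (deriv a t) t := ((ha.differentiable (by simp)) t).hasDerivAt
  have hdχ : HasDerivAt χ (deriv χ t) t := ((hχ.differentiable (by simp)) t).hasDerivAt
  have hdf : HasDerivAt f (deriv f t) t := ((hf.differentiable (by simp)) t).hasDerivAt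
  have h1 : HasDerivAt (fun s ↦ (1 - a s) • f s)
      ((1 - a t) • deriv f t + (-(deriv a t)) • f t) t := by
    have h := ((hasDerivAt_const t (1 : ℝ)).sub hda).smul hdf
    refine h.congr_deriv ?_
    simp
  have h2 : HasDerivAt (fun s ↦ (a s * (1 - (C * s ^ 2 + 2 * m * χ s))) • f₀)
      ((deriv a t * (1 - (C * t ^ 2 + 2 * m * χ t)) +
        a t * (-(2 * C * t + 2 * m * deriv χ t))) • f₀) t := by
    have hc : HasDerivAt (fun s ↦ a s * (1 - (C * s ^ 2 + 2 * m * χ s)))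
        (deriv a t * (1 - (C * t ^ 2 + 2 * m * χ t)) +
          a t * (-(2 * C * t + 2 * m * deriv χ t))) t := by
      have h := hda.mul ((hasDerivAt_const t (1 : ℝ)).sub
        (((hasDerivAt_id t).pow 2 |>.const_mul C).add (hdχ.const_mul (2 * m))))
      refine h.congr_deriv ?_
      simp only [Pi.sub_apply, Pi.add_apply, Pi.pow_apply, id_eq,
        Nat.cast_ofNat]
      ring
    exact hc.smul_const f₀
  have h3 : HasDerivAt (fun s ↦ (a s * (s - χ s)) • f₁)
      ((deriv a t * (t - χ t) + a t * (1 - deriv χ t)) • f₁) t := by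
    have hc : HasDerivAt (fun s ↦ a s * (s - χ s))
        (deriv a t * (t - χ t) + a t * (1 - deriv χ t)) t := by
      have h := hda.mul ((hasDerivAt_id t).sub hdχ)
      refine h.congr_deriv ?_
      simp only [Pi.sub_apply, id_eq]
    exact hc.smul_const f₁
  have h := (h1.add h2).add h3
  refine h.congr_deriv ?_
  module

/-- The first derivative as a function. [cite: BarHanke2023, §3, (16)] -/
theorem deriv_normalFormSlice (hf : ContDiff ℝ ∞ f) (ha : ContDiff ℝ ∞ a)
    (hχ : ContDiff ℝ ∞ χ) :
    deriv (fun s ↦ (1 - a s) • f s + (a s * (1 - (C * s ^ 2 + 2 * m * χ s))) • f₀ +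
        (a s * (s - χ s)) • f₁) =
      fun t ↦ -(deriv a t) • f t + (1 - a t) • deriv f t +
        (deriv a t * (1 - (C * t ^ 2 + 2 * m * χ t)) +
          a t * (-(2 * C * t + 2 * m * deriv χ t))) • f₀ +
        (deriv a t * (t - χ t) + a t * (1 - deriv χ t)) • f₁ :=
  funext fun t ↦ (hasDerivAt_normalFormSlice hf ha hχ t).deriv

/-- **Second time derivative of the deformed slices.** [cite: BarHanke2023, §3, (17)] -/
theorem hasDerivAt_deriv_normalFormSlice (hf : ContDiff ℝ ∞ f) (ha : ContDiff ℝ ∞ a)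
    (hχ : ContDiff ℝ ∞ χ) (t : ℝ) :
    HasDerivAt (deriv (fun s ↦ (1 - a s) • f s + (a s * (1 - (C * s ^ 2 + 2 * m * χ s))) • f₀ +
        (a s * (s - χ s)) • f₁))
      (-(deriv (deriv a) t) • f t - (2 * deriv a t) • deriv f t + (1 - a t) • deriv (deriv f) t +
        (deriv (deriv a) t * (1 - (C * t ^ 2 + 2 * m * χ t)) +
          2 * deriv a t * (-(2 * C * t + 2 * m * deriv χ t)) +
          a t * (-(2 * C + 2 * m * deriv (deriv χ) t))) • f₀ +
        (deriv (deriv a) t * (t - χ t) + 2 * deriv a t * (1 - deriv χ t) +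
          a t * (-(deriv (deriv χ) t))) • f₁) t := by
  rw [deriv_normalFormSlice hf ha hχ]
  have hda : HasDerivAt a (deriv a t) t := ((ha.differentiable (by simp)) t).hasDerivAt
  have hdda := hasDerivAt_deriv_of_contDiff ha t
  have hdχ : HasDerivAt χ (deriv χ t) t := ((hχ.differentiable (by simp)) t).hasDerivAt
  have hddχ := hasDerivAt_deriv_of_contDiff hχ t
  have hdf : HasDerivAt f (deriv f t) t := ((hf.differentiable (by simp)) t).hasDerivAt
  have hddf := hasDerivAt_deriv_of_contDiff_vec hf t
  -- the four summands
  have h1 : HasDerivAt (fun s ↦ -(deriv a s) • f s)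
      (-(deriv a t) • deriv f t + (-(deriv (deriv a) t)) • f t) t := by
    have h := hdda.neg.smul hdf
    refine h.congr_deriv ?_
    simp
  have h2 : HasDerivAt (fun s ↦ (1 - a s) • deriv f s)
      ((1 - a t) • deriv (deriv f) t + (-(deriv a t)) • deriv f t) t := by
    have h := ((hasDerivAt_const t (1 : ℝ)).sub hda).smul hddf
    refine h.congr_deriv ?_
    simp
  have h3 : HasDerivAt (fun s ↦ (deriv a s * (1 - (C * s ^ 2 + 2 * m * χ s)) +
        a s * (-(2 * C * s + 2 * m * deriv χ s))) • f₀)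
      ((deriv (deriv a) t * (1 - (C * t ^ 2 + 2 * m * χ t)) +
          2 * deriv a t * (-(2 * C * t + 2 * m * deriv χ t)) +
          a t * (-(2 * C + 2 * m * deriv (deriv χ) t))) • f₀) t := by
    have hc : HasDerivAt (fun s ↦ deriv a s * (1 - (C * s ^ 2 + 2 * m * χ s)) +
        a s * (-(2 * C * s + 2 * m * deriv χ s)))
        (deriv (deriv a) t * (1 - (C * t ^ 2 + 2 * m * χ t)) +
          2 * deriv a t * (-(2 * C * t + 2 * m * deriv χ t)) +
          a t * (-(2 * C + 2 * m * deriv (deriv χ) t))) t := by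
      have hA := hdda.mul ((hasDerivAt_const t (1 : ℝ)).sub
        (((hasDerivAt_id t).pow 2 |>.const_mul C).add (hdχ.const_mul (2 * m))))
      have hB := hda.mul ((((hasDerivAt_id t).const_mul (2 * C)).add
        (hddχ.const_mul (2 * m))).neg)
      have h := hA.add hB
      refine h.congr_deriv ?_
      simp only [Pi.sub_apply, Pi.add_apply, Pi.neg_apply, Pi.pow_apply, id_eq,
        Nat.cast_ofNat]
      ring
    exact hc.smul_const f₀
  have h4 : HasDerivAt (fun s ↦ (deriv a s * (s - χ s) + a s * (1 - deriv χ s)) • f₁)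
      ((deriv (deriv a) t * (t - χ t) + 2 * deriv a t * (1 - deriv χ t) +
          a t * (-(deriv (deriv χ) t))) • f₁) t := by
    have hc : HasDerivAt (fun s ↦ deriv a s * (s - χ s) + a s * (1 - deriv χ s))
        (deriv (deriv a) t * (t - χ t) + 2 * deriv a t * (1 - deriv χ t) +
          a t * (-(deriv (deriv χ) t))) t := by
      have hA := hdda.mul ((hasDerivAt_id t).sub hdχ)
      have hB := hda.mul ((hasDerivAt_const t (1 : ℝ)).sub hddχ)
      have h := hA.add hB
      refine h.congr_deriv ?_
      simp only [Pi.sub_apply, id_eq]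
      ring
    exact hc.smul_const f₁
  have h := ((h1.add h2).add h3).add h4
  refine h.congr_deriv ?_
  module

/-! ### Region B: `a ≡ 1` near `t` -/

/-- **Bär–Hanke (16)**: where `a ≡ 1` near `t`,
`ġ(t) = −(2Ct + 2mχ̇(t)) f₀ + (1 − χ̇(t)) f₁` (`= −2h − 2Ct g₀ + 2χ̇ (h − k)` with `h = −½ f₁`,
`k = m f₀`). [cite: BarHanke2023, §3, (16)] -/
theorem deriv_normalFormSlice_of_regionB (hf : ContDiff ℝ ∞ f) (ha : ContDiff ℝ ∞ a)
    (hχ : ContDiff ℝ ∞ χ) {t : ℝ} (hat : a t = 1) (ha' : deriv a t = 0) :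
    deriv (fun s ↦ (1 - a s) • f s + (a s * (1 - (C * s ^ 2 + 2 * m * χ s))) • f₀ +
        (a s * (s - χ s)) • f₁) t =
      (-(2 * C * t + 2 * m * deriv χ t)) • f₀ + (1 - deriv χ t) • f₁ := by
  rw [(hasDerivAt_normalFormSlice (C := C) (m := m) (f₀ := f₀) (f₁ := f₁) hf ha hχ t).deriv,
    hat, ha']
  module

/-- **Bär–Hanke (17)**: where `a ≡ 1` near `t`,
`g̈(t) = −2C f₀ + 2χ̈(t) (−m f₀ − ½ f₁)` (`= −2C g₀ + 2χ̈ (h − k)`).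
[cite: BarHanke2023, §3, (17)] -/
theorem deriv_deriv_normalFormSlice_of_regionB (hf : ContDiff ℝ ∞ f) (ha : ContDiff ℝ ∞ a)
    (hχ : ContDiff ℝ ∞ χ) {t : ℝ} (hat : a t = 1) (ha' : deriv a t = 0)
    (ha'' : deriv (deriv a) t = 0) :
    deriv (deriv (fun s ↦ (1 - a s) • f s + (a s * (1 - (C * s ^ 2 + 2 * m * χ s))) • f₀ +
        (a s * (s - χ s)) • f₁)) t =
      (-(2 * C)) • f₀ + (2 * deriv (deriv χ) t) • (-m • f₀ - (2⁻¹ : ℝ) • f₁) := by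
  rw [(hasDerivAt_deriv_normalFormSlice (C := C) (m := m) (f₀ := f₀) (f₁ := f₁) hf ha hχ t).deriv,
    hat, ha', ha'']
  module

/-! ### Region A: `χ ≡ 0` near `t` (the `C`-normalisation `g = f + a w`) -/

/-- Where `χ ≡ 0` near `t`: `ġ(t) = ḟ(t) + ȧ(t) w(t) + a(t) ẇ(t)` with
`w(t) = f₀ + t f₁ − C t² f₀ − f(t)`, `ẇ(t) = f₁ − 2Ct f₀ − ḟ(t)`.
[cite: BarHanke2023, §3, Prop. 23] -/
theorem deriv_normalFormSlice_of_regionA (hf : ContDiff ℝ ∞ f) (ha : ContDiff ℝ ∞ a)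
    (hχ : ContDiff ℝ ∞ χ) {t : ℝ} (hχt : χ t = 0) (hχ' : deriv χ t = 0) :
    deriv (fun s ↦ (1 - a s) • f s + (a s * (1 - (C * s ^ 2 + 2 * m * χ s))) • f₀ +
        (a s * (s - χ s)) • f₁) t =
      deriv f t + deriv a t • (f₀ + t • f₁ - (C * t ^ 2) • f₀ - f t) +
        a t • (f₁ - (2 * C * t) • f₀ - deriv f t) := by
  rw [(hasDerivAt_normalFormSlice (C := C) (m := m) (f₀ := f₀) (f₁ := f₁) hf ha hχ t).deriv,
    hχt, hχ']
  module

/-- Where `χ ≡ 0` near `t`: `g̈(t) = f̈(t) + ä w + 2ȧ ẇ + a ẅ` with `ẅ = −2C f₀ − f̈(t)`, i.e.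
`g̈ = f̈ + r + a (−f̈ − 2C f₀)` with `r = ä w + 2 ȧ ẇ`. [cite: BarHanke2023, §3, Prop. 23] -/
theorem deriv_deriv_normalFormSlice_of_regionA (hf : ContDiff ℝ ∞ f) (ha : ContDiff ℝ ∞ a)
    (hχ : ContDiff ℝ ∞ χ) {t : ℝ} (hχt : χ t = 0) (hχ' : deriv χ t = 0)
    (hχ'' : deriv (deriv χ) t = 0) :
    deriv (deriv (fun s ↦ (1 - a s) • f s + (a s * (1 - (C * s ^ 2 + 2 * m * χ s))) • f₀ +
        (a s * (s - χ s)) • f₁)) t =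
      deriv (deriv f) t +
        (deriv (deriv a) t • (f₀ + t • f₁ - (C * t ^ 2) • f₀ - f t) +
          (2 * deriv a t) • (f₁ - (2 * C * t) • f₀ - deriv f t)) +
        a t • (-deriv (deriv f) t - (2 * C) • f₀) := by
  rw [(hasDerivAt_deriv_normalFormSlice (C := C) (m := m) (f₀ := f₀) (f₁ := f₁) hf ha hχ t).deriv,
    hχt, hχ', hχ'']
  module

end Literature.Geometry.Riemannian

end
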